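import Literature.Geometry.Kaehler.ChartWindowCutoff
import Literature.Geometry.Kaehler.HolomorphicChainBlowUpPiece
import Literature.Geometry.GeometricMeasureTheory.PushforwardRectifiable
import Literature.Geometry.GeometricMeasureTheory.CurrentsConstancy

/-!
# Blow-ups of a holomorphic chain read in a chart window: the projected core piece

Let `T` be a holomorphic `p`-chain (`p = q + 1 ≥ 1`), `D_r` its blow-up at `b` with radius `r`,
and `W` a chart window (`ChartWindow.lean`) whose closed tube lies in `𝐁(0, ρ₀)`, `ρ₀ < 1`, such
that **the pulled-back carrier is vertically close to the graph inside the tube**,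
`A_r⁻¹(reg|T|) ∩ closedTube ⊆ {‖w‖ < τ/16}` (for the windows of the tangent cone this holds for
all small `r`, by the limit-cone localisation `HolomorphicChain.eventually_forall_mem_of_blowUp`).
Then:

* `HolomorphicChain.corePiece` — the piece `D_r ⌞ innerCore(W)` (a rectifiable current on `V`)
  has support in `{‖k‖ ≤ a₃, ‖w‖ ≤ τ/16}`, where the cutoff `χ` of the window equals `1`;
* `HolomorphicChain.projPiece` — its projection `Q = q_#(D_r ⌞ innerCore)` onto the affine
  tangent plane `m + K` (`q = ChartWindow.proj`) is rectifiable, representable, supported in the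
  plane, and **has no boundary in the slab `{‖k‖ < a₃}`** (`boundary_projPiece_apply_eq_zero`:
  `∂ q_# = q_# ∂`, and `∂(D_r ⌞ innerCore)` vanishes on forms supported in the inner core);
* `HolomorphicChain.exists_int_restrictSet_projPiece_eq` — by the **constancy theorem**
  (`Current.IsRectifiable.exists_int_restrictSet_eq_face`) there is an integer `c` with
  `Q ⌞ {‖k‖ < a₃} = c · [m + ball_K(0, a₃)]` (oriented by the real frame of a unitary basis of `K`):
  **the sheet number of `D_r` over the window**.

Definitions with bodies + theorems; no named facts.

## References

* H. Federer, *Geometric Measure Theory*, Springer 1969, 4.1.7, 4.1.31, 4.3.16–4.3.18 [Federer1969].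
* J. R. King, *The currents defined by analytic varieties*, Acta Math. 127 (1971), §5.
-/

noncomputable section

open scoped Manifold Topology ENNReal NNReal InnerProductSpace ContDiff Distributions
open Set Filter MeasureTheory Metric Function Module TopologicalSpace

namespace Literature.Geometry.Kaehler

open Literature.Geometry.GeometricMeasureTheory

-- Nested operator-norm instances on (duals of) `V [⋀^Fin n]→L[ℝ] ℝ`.
set_option maxSynthPendingDepth 2

universe u

variable {V : Type u} [NormedAddCommGroup V] [InnerProductSpace ℂ V] [FiniteDimensional ℂ V]
  [MeasurableSpace V] [BorelSpace V] {Ω : Opens V} {q : ℕ}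

omit [MeasurableSpace V] [BorelSpace V] in
/-- **Pull-backs by the affine projection of forms supported in the slab are supported in the
inner core** (the cutoff confines them vertically, `k ∘ q = k` laterally). [folklore] -/
theorem _root_.Literature.Geometry.Kaehler.ChartWindow.tsupport_pullback_cutoff_subset_innerCore
    (W : ChartWindow V) {M : ℝ} (hM : ∀ k ∈ ball (0 : W.K) W.ρ, ‖fderiv ℂ W.Ψ k‖ ≤ M) {m : ℕ}
    (φ : TestForm (⊤ : Opens V) m) (hφ : tsupport ⇑φ ⊆ {x | ‖W.kf x‖ < W.a₃}) :
    tsupport ⇑(TestForm.pullback (W.cutoff hM) W.contDiff_proj φ) ⊆ W.innerCore := by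
  intro x hx
  have hχ := TestForm.tsupport_pullback_subset (W.cutoff hM) W.contDiff_proj φ hx
  have hq := TestForm.tsupport_pullback_subset_preimage (W.cutoff hM) W.contDiff_proj φ hx
  have hk : ‖W.kf x‖ < W.a₃ := by
    have := hφ hq
    simpa only [mem_setOf_eq, W.kf_proj] using this
  exact W.mem_innerCore_of_tsupport_cutoff hM hχ hk

namespace HolomorphicChain

/-- **The core piece `D_r ⌞ innerCore(W)`** of the blow-up in the window. [cite: Federer1969, 4.3.16] -/
def corePiece (T : HolomorphicChain 𝓘(ℂ, V) Ω (q + 1)) (b : V) (r : ℝ) (W : ChartWindow V) :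
    Current (⊤ : Opens V) (2 * (q + 1)) :=
  T.blowUpPiece b r W.innerCore

/-- **The projected core piece `Q = q_#(D_r ⌞ innerCore)`** on the affine tangent plane.
[cite: Federer1969, 4.1.7, 4.3.16] -/
def projPiece (T : HolomorphicChain 𝓘(ℂ, V) Ω (q + 1)) (b : V) (r : ℝ) (W : ChartWindow V) {M : ℝ}
    (hM : ∀ k ∈ ball (0 : W.K) W.ρ, ‖fderiv ℂ W.Ψ k‖ ≤ M) : Current (⊤ : Opens V) (2 * (q + 1)) :=
  (T.corePiece b r W).pushforward ⊤ (W.cutoff hM) W.contDiff_proj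

section Core

variable (T : HolomorphicChain 𝓘(ℂ, V) Ω (q + 1)) {b : V} {r : ℝ} (hr : 0 < r)
  (hball : ball b r ⊆ (Ω : Set V)) (W : ChartWindow V) {ρ₀ : ℝ} (hρ₀ : ρ₀ < 1)
  (hW : W.closedTube ⊆ closedBall (0 : V) ρ₀)
  (htube : T.blowUpSet b r ∩ W.closedTube ⊆ {x | ‖W.wf x‖ < W.τ / 16})

omit [MeasurableSpace V] [BorelSpace V] in
include hW in
/-- `innerCore ⊆ 𝐁(0, ρ₀)`. [folklore] -/
theorem innerCore_subset_closedBall : W.innerCore ⊆ closedBall (0 : V) ρ₀ :=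
  ((W.innerCore_subset_core.trans W.core_subset_tube).trans W.tube_subset_closedTube).trans hW

include hr hball hρ₀ hW in
/-- The core piece is a rectifiable current. [cite: Federer1969, 4.1.28, 4.3.16] -/
theorem isRectifiable_corePiece :
    letI : InnerProductSpace ℝ V := InnerProductSpace.complexToReal
    (T.corePiece b r W).IsRectifiable :=
  T.isRectifiable_blowUpPiece hr hball W.isOpen_innerCore.measurableSet hρ₀
    (innerCore_subset_closedBall W hW)

include htube in
/-- **Localisation of the core piece**: `spt(D_r ⌞ innerCore) ⊆ {‖k‖ ≤ a₃, ‖w‖ ≤ τ/16}`. [folklore] -/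
theorem support_corePiece_subset :
    (T.corePiece b r W).support ⊆ {x | ‖W.kf x‖ ≤ W.a₃ ∧ ‖W.wf x‖ ≤ W.τ / 16} := by
  refine (support_currentOfIntegration_subset_closure _ _ _).trans
    (closure_minimal ?_ (W.isClosed_sublevel (W.a₃_lt.trans (W.a₂_lt.trans W.a₁_lt))))
  rintro x ⟨hxW, hxI⟩
  have hxt : x ∈ W.closedTube :=
    W.tube_subset_closedTube (W.core_subset_tube (W.innerCore_subset_core hxI))
  exact ⟨hxI.1.le, (htube ⟨hxW, hxt⟩).le⟩

include htube in
/-- The support of the core piece lies in the open set where the cutoff is `1`. [folklore] -/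
theorem support_corePiece_subset_cutoffOne : (T.corePiece b r W).support ⊆ W.cutoffOne :=
  (support_corePiece_subset T W htube).trans fun _ hx =>
    ⟨lt_of_le_of_lt hx.1 W.a₃_lt_aLo, lt_of_le_of_lt hx.2 (by linarith [W.τ_pos])⟩

include hr hball hρ₀ hW htube in
/-- **The projected core piece is rectifiable** (push-forward of a rectifiable current, the cutoff
being `1` near its support). [cite: Federer1969, 4.1.30] -/
theorem isRectifiable_projPiece {M : ℝ} (hM : ∀ k ∈ ball (0 : W.K) W.ρ, ‖fderiv ℂ W.Ψ k‖ ≤ M) :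
    letI : InnerProductSpace ℝ V := InnerProductSpace.complexToReal
    (T.projPiece b r W hM).IsRectifiable := by
  letI : InnerProductSpace ℝ V := InnerProductSpace.complexToReal
  exact (isRectifiable_corePiece T hr hball W hρ₀ hW).pushforward_top (W.cutoff hM)
    (fun x hx => W.cutoff_eq_one hM (support_corePiece_subset_cutoffOne T W htube hx)) W.contDiff_proj

/-- The projected core piece is supported in the affine tangent plane `m + K`. [folklore] -/
theorem support_projPiece_subset {M : ℝ} (hM : ∀ k ∈ ball (0 : W.K) W.ρ, ‖fderiv ℂ W.Ψ k‖ ≤ M) :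
    (T.projPiece b r W hM).support ⊆ {x | x - W.m ∈ W.K} :=
  ((T.corePiece b r W).support_pushforward_subset_image (W.cutoff hM) W.contDiff_proj).trans
    (by rintro _ ⟨x, -, rfl⟩; exact W.proj_sub_mem x)

include hr hball hρ₀ hW htube in
/-- **No boundary in the slab**: `∂Q(φ) = 0` for every `φ` supported in `{‖k‖ < a₃}`.
[cite: Federer1969, 4.1.7, 4.1.14] -/
theorem boundary_projPiece_apply_eq_zero {M : ℝ} (hM : ∀ k ∈ ball (0 : W.K) W.ρ, ‖fderiv ℂ W.Ψ k‖ ≤ M)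
    (φ : TestForm (⊤ : Opens V) (2 * q + 1)) (hφ : tsupport ⇑φ ⊆ {x | ‖W.kf x‖ < W.a₃}) :
    (T.projPiece b r W hM).boundary φ = 0 := by
  have h1 : (T.projPiece b r W hM).boundary =
      (T.corePiece b r W).boundary.pushforward ⊤ (W.cutoff hM) W.contDiff_proj :=
    (T.corePiece b r W).boundary_pushforward (W.cutoff hM) W.contDiff_proj W.isOpen_cutoffOne
      (support_corePiece_subset_cutoffOne T W htube) fun x hx => W.cutoff_eq_one hM hx
  rw [h1, Current.pushforward_apply, Current.boundary_apply]
  have := T.boundary_blowUpPiece_apply_eq_zero hr hball W.isOpen_innerCore.measurableSet hρ₀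
    (innerCore_subset_closedBall W hW) (subset_refl W.innerCore) _
    (W.tsupport_pullback_cutoff_subset_innerCore hM φ hφ)
  rwa [Current.boundary_apply] at this

end Core

/-! ### The sheet number over the window -/

section Sheets

variable (T : HolomorphicChain 𝓘(ℂ, V) Ω (q + 1)) {b : V} {r : ℝ} (hr : 0 < r)
  (hball : ball b r ⊆ (Ω : Set V)) (W : ChartWindow V) (hKp : finrank ℂ W.K = q + 1) {ρ₀ : ℝ}
  (hρ₀ : ρ₀ < 1) (hW : W.closedTube ⊆ closedBall (0 : V) ρ₀)
  (htube : T.blowUpSet b r ∩ W.closedTube ⊆ {x | ‖W.wf x‖ < W.τ / 16})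

/-- The slab `{‖k‖ < a₃}`. [folklore] -/
def _root_.Literature.Geometry.Kaehler.ChartWindow.slab (W : ChartWindow V) : Set V :=
  {x | ‖W.kf x‖ < W.a₃}

omit [MeasurableSpace V] [BorelSpace V] in
/-- The slab is open. [folklore] -/
theorem _root_.Literature.Geometry.Kaehler.ChartWindow.isOpen_slab (W : ChartWindow V) : IsOpen W.slab :=
  isOpen_lt (continuous_norm.comp W.contDiff_kf.continuous) continuous_const

omit [MeasurableSpace V] [BorelSpace V] in
/-- The disc `slab ∩ (m + K)` is the isometric image of `ball_K(0, a₃)`. [folklore] -/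
theorem _root_.Literature.Geometry.Kaehler.ChartWindow.slab_inter_plane_eq (W : ChartWindow V) :
    W.slab ∩ {x | x - W.m ∈ W.K} = (fun k : W.K => W.m + (k : V)) '' ball (0 : W.K) W.a₃ := by
  ext x
  simp only [ChartWindow.slab, mem_inter_iff, mem_setOf_eq, mem_image, mem_ball_zero_iff]
  constructor
  · rintro ⟨hk, hx⟩
    refine ⟨⟨x - W.m, hx⟩, ?_, by simp⟩
    have : W.kf x = ⟨x - W.m, hx⟩ := by
      simp only [ChartWindow.kf]
      exact W.K.orthogonalProjectionOnto_mem_subspace_eq_self ⟨x - W.m, hx⟩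
    rwa [this] at hk
  · rintro ⟨k, hk, rfl⟩
    have : W.kf (W.m + (k : V)) = k := by
      simp only [ChartWindow.kf, add_sub_cancel_left]
      exact W.K.orthogonalProjectionOnto_mem_subspace_eq_self k
    exact ⟨by rwa [this], by simp⟩

omit [MeasurableSpace V] [BorelSpace V] in
/-- The disc is convex, hence preconnected. [folklore] -/
theorem _root_.Literature.Geometry.Kaehler.ChartWindow.isPreconnected_slab_inter_plane (W : ChartWindow V) :
    IsPreconnected (W.slab ∩ {x | x - W.m ∈ W.K}) := by
  letI : NormedSpace ℝ V := NormedSpace.complexToReal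
  rw [W.slab_inter_plane_eq]
  refine ((convex_ball (0 : W.K) W.a₃).isPreconnected.image _ ?_)
  exact (continuous_const.add continuous_subtype_val).continuousOn

/-- The disc has finite `𝓗^{2p}`-measure. [folklore] -/
theorem _root_.Literature.Geometry.Kaehler.ChartWindow.measure_slab_inter_plane_lt_top (W : ChartWindow V)
    {q : ℕ} (hKp : finrank ℂ W.K = q + 1) :
    letI : InnerProductSpace ℝ V := InnerProductSpace.complexToReal
    (μHE[2 * (q + 1)] : Measure V) (W.slab ∩ {x | x - W.m ∈ W.K}) < ⊤ := by
  letI : InnerProductSpace ℝ V := InnerProductSpace.complexToReal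
  letI : InnerProductSpace ℝ W.K := InnerProductSpace.complexToReal
  letI : MeasurableSpace W.K := borel W.K
  haveI : BorelSpace W.K := ⟨rfl⟩
  haveI : FiniteDimensional ℝ W.K := FiniteDimensional.complexToReal W.K
  have hiso : Isometry (fun k : W.K => W.m + (k : V)) :=
    Isometry.of_dist_eq fun x y => by
      rw [dist_eq_norm, dist_eq_norm, add_sub_add_left_eq_sub, ← Submodule.coe_sub, Submodule.coe_norm]
  have hdim : finrank ℝ W.K = 2 * (q + 1) := by rw [finrank_real_of_complex, hKp]
  rw [W.slab_inter_plane_eq, hiso.euclideanHausdorffMeasure_image, ← hdim,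
    InnerProductSpace.euclideanHausdorffMeasure_eq_volume]
  exact measure_ball_lt_top

include hr hball hKp hρ₀ hW htube in
/-- **The sheet number of `D_r` over the window**: by the constancy theorem there is an integer
`c` with `Q ⌞ {‖k‖ < a₃} = c · [m + ball_K(0,a₃)]`, oriented by the real frame `(b₀, I b₀, …)`
of a unitary basis of `K`. [cite: Federer1969, 4.1.31, 4.3.16; King 1971, §5] -/
theorem exists_int_restrictSet_projPiece_eq {M : ℝ} (hM : ∀ k ∈ ball (0 : W.K) W.ρ, ‖fderiv ℂ W.Ψ k‖ ≤ M)
    (bK : OrthonormalBasis (Fin (q + 1)) ℂ W.K) :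
    letI : InnerProductSpace ℝ V := InnerProductSpace.complexToReal
    letI : InnerProductSpace ℝ W.K := InnerProductSpace.complexToReal
    ∀ e : OrthonormalBasis (Fin (2 * (q + 1))) ℝ W.K, ⇑e = complexFrame ⇑bK →
    ∃ (hQr : (T.projPiece b r W hM).IsRepresentable) (c : ℤ),
      hQr.restrictSet W.slab W.isOpen_slab.measurableSet =
        currentOfIntegration (W.slab ∩ {x | x - W.m ∈ W.K}) (fun _ => c)
          (fun _ => fun i => ((e i : W.K) : V)) := by
  letI : InnerProductSpace ℝ V := InnerProductSpace.complexToReal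
  letI : InnerProductSpace ℝ W.K := InnerProductSpace.complexToReal
  intro e he
  have hQ := isRectifiable_projPiece T hr hball W hρ₀ hW htube hM
  obtain ⟨⟨W', θ', ξ', hdata, hQeq⟩, -⟩ := hQ
  have hQr : (T.projPiece b r W hM).IsRepresentable := by
    rw [hQeq]; exact hdata.isRepresentable
  refine ⟨hQr, ?_⟩
  -- the hypotheses of the constancy theorem
  have hP₀ : Module.finrank ℝ (W.K.restrictScalars ℝ) = 2 * q + 1 + 1 := by
    change Module.finrank ℝ W.K = _
    rw [finrank_real_of_complex, hKp]; ring
  have he' : Orthonormal ℝ fun i => ((e i : W.K) : V) := by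
    have := e.orthonormal
    rw [orthonormal_iff_ite] at this ⊢
    intro i j
    rw [← this i j]
    rfl
  have heP : ∀ i, ((e i : W.K) : V) ∈ W.K.restrictScalars ℝ := fun i => (e i).2
  have hsupp : (T.projPiece b r W hM).support ∩ W.slab ⊆ {x | x - W.m ∈ W.K.restrictScalars ℝ} :=
    fun x hx => support_projPiece_subset T W hM hx.1
  have hfin : (μHE[2 * q + 1 + 1] : Measure V) (W.slab ∩ {x | x - W.m ∈ W.K.restrictScalars ℝ}) ≠ ⊤ :=
    (W.measure_slab_inter_plane_lt_top hKp).ne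
  obtain ⟨c, hc⟩ := Current.IsRectifiable.exists_int_restrictSet_eq_face
    (S := (T.projPiece b r W hM : Current (⊤ : Opens V) (2 * q + 1 + 1)))
    (isRectifiable_projPiece T hr hball W hρ₀ hW htube hM) hQr (W.K.restrictScalars ℝ) W.m hP₀ he'
    heP W.isOpen_slab (W.isPreconnected_slab_inter_plane) hfin hsupp
    (fun φ hφ => boundary_projPiece_apply_eq_zero T hr hball W hρ₀ hW htube hM φ hφ)
  exact ⟨c, hc⟩

end Sheets

end HolomorphicChain

end Literature.Geometry.Kaehler
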